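import Summits.QuantumFields.YangMills.Theorems.LuscherReductionDressedRitzPolyakovLiftTransplantAE
import Summits.QuantumFields.YangMills.Theorems.LuscherReductionDressedRitzPolyakovLiftTransplantChart
import Summits.QuantumFields.YangMills.Theorems.LuscherReductionOneSiteLevelsL2Pos
import HarnessLib

/-!
# Route `LuscherReduction`, crux `DressedRitz` (stmt-QuantumFields-20205), line «polyakovlift» r6/r7 — NEGATIVE LEMMA (tightness):
# THE ECHO ZONE — the main-term identity `(g_i∘powLink L)·Φ̂₀^{R_v} = Ψ_{i+1}` fails beyond the first echo shell

Negative-side module of the standing crux disprover (seat ym-cdisprove-20205-1 g8; `--supports stmt-QuantumFields-20205`).  It records, as kernel facts, why the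
vacuum trial state of the S-PSCAL″/`pscaling_of_groundStateLowerBound` assembly MUST be supported inside the first echo shell `‖y‖ ≲ 2π/Λ` — so that the
vacuum-defect floor `e^{-R_v/2} ≥ e^{-c/Λ}` of `Negative/VacuumTrialRadius` (p561227) is FORCED and the `e^{-1.1/Λ} ≲ Λ²` budget of the r7 line (fleet INBOX
2026-08-27T19:56:52Z) cannot be relaxed by enlarging `R_v`:

* §1 `gnLink_pow_of_scalarPart_pos` — de Moivre in the gnomonic coordinate for ALL powers, `gn(W^m) = (tan mθ / tan θ)·gn W`, `θ = arctan|gn W|`, with no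
  principal-shell hypothesis (`scalarPart_pow_of_scalarPart_pos`: `scalarPart(W^m) = cos mθ`);
* §2 the ECHO PARTNER `echoLink L W` (same axis, angle `θ + π/L`) and ★★ `gnLink_echoLink_pow`: `gn((echoLink L W)^L) = gn(W^L)` — the root chart
  `rootCoord L μ ∘ powLink L` does not separate a near-centre link from its echo;
* §3 the fold / echo configurations of a point `y ∈ ℝ⁹` and ★★ `transplantObsL_powLink_echoCfg`: on the echo configuration of `y` the one-site shadow
  `g_i∘powLink L` takes the value `(χ_R f_{i+1}/f_0)(y)` although `gn(echoCfg) ` lies at gnomonic radius `≥ 2π/Λ` (`linkNormSq_gnCoord_echoCfg_zero`);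
* (sequel `Negative/EchoZoneFailure.lean`) §4 ★★★ `shadow_identity_fails_at_echo` / `shadowObs_mul_ground_not_ae_beyond_echo` — the identity fails pointwise at
  every echo configuration the vacuum cut-off reaches, hence on a set of positive `configMeasure`; §5 the explicit threshold `R_v·Λ ≥ 14`, `L ≥ 4`.

Reading for the line: hypothesis `hprod` of `concentration_transfer` (`…ShadowVectorTransfer`, p563069) is available from `shadowObs_mul_ground_ae` (`…TransplantAE`,
p557164) exactly while `√2·R_v·Λ < 2π·(1 − O(1/L))`; past that radius no choice of `R`, `f`, `L` restores it.  HONEST FRAMING: finite-dimensional chart geometry on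
`SU(2)³`; nothing here bears on infinite volume, the continuum limit or the Clay gap, and it does not refute `DressedRitz` — it pins a load-bearing constant of the
current line.  References: M. Lüscher, NPB 219 (1983) 233 [cite: Luscher1983, §2–§3]; Bröcker–tom Dieck, Representations of Compact Lie Groups
[cite: BrockerTomDieck1985, I (1.10)].
-/

set_option autoImplicit false

noncomputable section

open MeasureTheory Filter Topology Real
open Literature.MathematicalPhysics.QuantumFieldTheory (GaugeConfig Site gaugeTransform)
open Literature.Analysis.OperatorTheory.YMMatrixModel
open Literature.MathematicalPhysics.QuantumFieldTheory.Balaban1983to89.T4CubeChartGnomonic (gnoPoint continuous_gnoPoint)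
open scoped BigOperators

namespace Summit.QuantumFields.YangMills.Theorems.FemtoTransferGap.PolyakovLift.Negative

open Summit.QuantumFields.YangMills.Theorems.FemtoTransferGap
open Summit.QuantumFields.YangMills.Theorems.FemtoTransferGap.PolyakovLift

/-! ## §1 De Moivre for the gnomonic coordinate, WITHOUT the principal-shell hypothesis -/

/-- For a link in the open upper hemisphere, `θ := arctan |gn W|` is its angle: `cos θ = scalarPart W`, `sin θ = |vecPart W|`, `0 ≤ θ < π/2`. [folklore] -/
theorem angle_of_scalarPart_pos {W : SU2} (hs : 0 < scalarPart W) :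
    Real.cos (Real.arctan (gnNorm W)) = scalarPart W ∧ Real.sin (Real.arctan (gnNorm W)) = Real.sqrt (∑ a, vecPart W a ^ 2) ∧
      0 ≤ Real.arctan (gnNorm W) ∧ Real.arctan (gnNorm W) < π / 2 := by
  set s := scalarPart W with hsdef
  have hs1 : s ≤ 1 := (le_abs_self s).trans (abs_scalarPart_le W)
  set θ := Real.arccos s with hθdef
  have hcos : Real.cos θ = s := Real.cos_arccos (by linarith) hs1
  have hq : ∑ a, vecPart W a ^ 2 = 1 - s ^ 2 := sum_vecPart_sq W
  have hsin : Real.sin θ = Real.sqrt (∑ a, vecPart W a ^ 2) := by rw [hθdef, Real.sin_arccos, hq]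
  have hθ0 : 0 ≤ θ := Real.arccos_nonneg s
  have hθlt : θ < π / 2 := Real.arccos_lt_pi_div_two.mpr hs
  have htan : gnNorm W = Real.tan θ := by rw [gnNorm_eq_of_pos hs, Real.tan_eq_sin_div_cos, hsin, hcos]
  have harc : Real.arctan (gnNorm W) = θ := by
    rw [htan]; exact Real.arctan_tan (by linarith [Real.pi_pos]) hθlt
  rw [harc]
  exact ⟨hcos, hsin, hθ0, hθlt⟩

/-- ★ **De Moivre in the gnomonic coordinate, all powers**: for `W` in the open upper hemisphere and every `m`,
`gn(W^m) = (tan(m·θ)/tan θ) · gn W` with `θ = arctan|gn W|` (`tan θ = |gn W|`; both sides are `0` when `W^m` lies ON the equator, by `x/0 = 0`).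
[cite: BrockerTomDieck1985, I (1.10)] -/
theorem gnLink_pow_of_scalarPart_pos {W : SU2} (hs : 0 < scalarPart W) (m : ℕ) (a : Fin 3) :
    gnLink (W ^ m) a = Real.tan (m * Real.arctan (gnNorm W)) / gnNorm W * gnLink W a := by
  obtain ⟨hcos, hsin, hθ0, hθlt⟩ := angle_of_scalarPart_pos hs
  set θ := Real.arctan (gnNorm W) with hθdef
  have htan : gnNorm W = Real.tan θ := (Real.tan_arctan _).symm
  set q : ℝ := ∑ b, vecPart W b ^ 2 with hqdef
  have hq0 : 0 ≤ q := Finset.sum_nonneg fun _ _ => sq_nonneg _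
  obtain ⟨hsc, hvc⟩ := scalarPart_pow_vecPart_pow W m
  have hps : powSeq (scalarPart W) (∑ b, vecPart W b ^ 2) = powSeq (Real.cos θ) (Real.sin θ ^ 2) := by
    rw [hcos, hsin, Real.sq_sqrt hq0]
  rw [hps] at hsc hvc
  obtain ⟨ht1, ht2⟩ := powSeq_trig θ m
  set T := (powSeq (Real.cos θ) (Real.sin θ ^ 2) m).2 with hTdef
  rw [ht1] at hsc
  rw [gnLink_apply, gnLink_apply, hsc, hvc, Pi.smul_apply, smul_eq_mul, htan, Real.tan_eq_sin_div_cos, Real.tan_eq_sin_div_cos, hcos]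
  have hsin0 : 0 ≤ Real.sin θ := by rw [hsin]; exact Real.sqrt_nonneg _
  rcases hsin0.eq_or_lt with h0 | hsinpos
  · -- on the axis: `vecPart W = 0`
    have hqz : q = 0 := by
      have : Real.sqrt q = 0 := by rw [hqdef, ← hsin, ← h0]
      rwa [Real.sqrt_eq_zero hq0] at this
    have hva : vecPart W a = 0 := by
      have := (Finset.sum_eq_zero_iff_of_nonneg (fun b _ => sq_nonneg (vecPart W b))).1 hqz a (Finset.mem_univ a)
      exact pow_eq_zero_iff (n := 2) (by norm_num) |>.1 this
    rw [hva]; simp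
  · rw [← ht2]
    have hc : Real.cos θ ≠ 0 := by rw [hcos]; exact hs.ne'
    by_cases hcm : Real.cos (m * θ) = 0
    · rw [hcm]; simp
    · field_simp


/-! ## §2 The echo partner of a link: same axis, angle advanced by `π/L` -/

/-- The ECHO PARTNER of a link `W` of the open upper hemisphere: the chart point with the same axis and gnomonic radius `tan(π/L + arctan|gn W|)`,
i.e. the link at angle `θ + π/L`, `θ = arctan|gn W|`. [folklore] -/
def echoLink (L : ℕ) (W : SU2) : SU2 :=
  gnoPoint ((Real.tan (π / L + Real.arctan (gnNorm W)) / gnNorm W) • gnLink W)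

/-- `gn(echoLink L W) = (tan(π/L + θ)/|gn W|) · gn W`. [folklore] -/
theorem gnLink_echoLink (L : ℕ) (W : SU2) :
    gnLink (echoLink L W) = (Real.tan (π / L + Real.arctan (gnNorm W)) / gnNorm W) • gnLink W :=
  gnLink_gnoPoint _

/-- The echo partner lies in the open upper hemisphere. [folklore] -/
theorem scalarPart_echoLink_pos (L : ℕ) (W : SU2) : 0 < scalarPart (echoLink L W) :=
  scalarPart_gnoPoint_pos _

/-- The echo angle `π/L + θ` is in `(0, π/2)` as soon as `π/L + θ < π/2` (`θ ≥ 0`). [folklore] -/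
theorem echoAngle_pos (L : ℕ) (W : SU2) : 0 ≤ π / L + Real.arctan (gnNorm W) := by
  have h1 : 0 ≤ π / L := div_nonneg Real.pi_pos.le (Nat.cast_nonneg L)
  have h2 : 0 ≤ Real.arctan (gnNorm W) := by
    have := Real.arctan_strictMono.monotone (gnNorm_nonneg W); rwa [Real.arctan_zero] at this
  linarith

/-- `|gn(echoLink L W)| = tan(π/L + θ)` for `W` off the axis with `π/L + θ < π/2`. [folklore] -/
theorem gnNorm_echoLink {L : ℕ} {W : SU2} (hW : 0 < gnNorm W) (hang : π / L + Real.arctan (gnNorm W) < π / 2) :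
    gnNorm (echoLink L W) = Real.tan (π / L + Real.arctan (gnNorm W)) := by
  have hα0 : 0 ≤ π / L + Real.arctan (gnNorm W) := echoAngle_pos L W
  have htan0 : 0 ≤ Real.tan (π / L + Real.arctan (gnNorm W)) := Real.tan_nonneg_of_nonneg_of_le_pi_div_two hα0 hang.le
  have hsum : ∑ a, gnLink (echoLink L W) a ^ 2 = (Real.tan (π / L + Real.arctan (gnNorm W)) / gnNorm W) ^ 2 * ∑ a, gnLink W a ^ 2 := by
    simp only [gnLink_echoLink, Pi.smul_apply, smul_eq_mul, mul_pow, Finset.mul_sum]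
  rw [gnNorm, hsum, Real.sqrt_mul (sq_nonneg _), Real.sqrt_sq (div_nonneg htan0 (gnNorm_nonneg W))]
  show Real.tan (π / L + Real.arctan (gnNorm W)) / gnNorm W * gnNorm W = _
  rw [div_mul_cancel₀ _ hW.ne']

/-- The angle of the echo partner is `π/L + θ`. [folklore] -/
theorem arctan_gnNorm_echoLink {L : ℕ} {W : SU2} (hW : 0 < gnNorm W) (hang : π / L + Real.arctan (gnNorm W) < π / 2) :
    Real.arctan (gnNorm (echoLink L W)) = π / L + Real.arctan (gnNorm W) := by
  rw [gnNorm_echoLink hW hang]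
  exact Real.arctan_tan (by linarith [echoAngle_pos L W, Real.pi_pos]) hang

/-- ★★ **ECHO**: the `L`-th powers of a link and of its echo partner have the SAME gnomonic coordinate — `gn((echoLink L W)^L) = gn(W^L)` (`L ≥ 1`, `W` off the axis in
the open upper hemisphere, `π/L + θ < π/2`): the root chart `rootCoord L μ ∘ powLink L` cannot tell a near-centre link from its echo one shell out.
[cite: BrockerTomDieck1985, I (1.10)] -/
theorem gnLink_echoLink_pow {L : ℕ} (hL : 0 < L) {W : SU2} (hs : 0 < scalarPart W) (hW : 0 < gnNorm W)
    (hang : π / L + Real.arctan (gnNorm W) < π / 2) : gnLink (echoLink L W ^ L) = gnLink (W ^ L) := by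
  have hL' : (L : ℝ) ≠ 0 := Nat.cast_ne_zero.mpr hL.ne'
  have htanα : 0 < Real.tan (π / L + Real.arctan (gnNorm W)) := by
    have h1 : 0 < π / L := div_pos Real.pi_pos (Nat.cast_pos.mpr hL)
    have h2 : 0 ≤ Real.arctan (gnNorm W) := by
      have := Real.arctan_strictMono.monotone (gnNorm_nonneg W); rwa [Real.arctan_zero] at this
    exact Real.tan_pos_of_pos_of_lt_pi_div_two (by linarith) hang
  have key : ∀ A t g x : ℝ, t ≠ 0 → A / t * (t / g * x) = A / g * x := by
    intro A t g x ht
    field_simp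
  funext a
  rw [gnLink_pow_of_scalarPart_pos (scalarPart_echoLink_pos L W) L a, gnLink_pow_of_scalarPart_pos hs L a, arctan_gnNorm_echoLink hW hang,
    gnNorm_echoLink hW hang, gnLink_echoLink, Pi.smul_apply, smul_eq_mul]
  have hmul : (L : ℝ) * (π / L + Real.arctan (gnNorm W)) = (L : ℝ) * Real.arctan (gnNorm W) + π := by
    rw [mul_add, mul_div_cancel₀ _ hL', add_comm]
  rw [hmul, Real.tan_add_pi]
  exact key _ _ _ _ htanα.ne'

/-! ## §3 Fold and echo configurations; the exact value of the shadow observable on an echo configuration -/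

/-- The FOLD configuration with gnomonic coordinate `y` at scale `μ`: every link the upper-hemisphere chart point `P(1, μ·y_j)`. [folklore] -/
def foldCfg (μ : ℝ) (y : ZM) : Cfg := fun e => gnoPoint (fun a => μ * y (e.2, a))

/-- The ECHO configuration of `y`: the fold configuration with link `0` replaced by its echo partner. [folklore] -/
def echoCfg (L : ℕ) (μ : ℝ) (y : ZM) : Cfg := fun e => if e.2 = 0 then echoLink L (foldCfg μ y e) else foldCfg μ y e

/-- `foldCfg μ y (edgeOf j) = P(1, μ·y_j)`. [folklore] -/
theorem foldCfg_edgeOf (μ : ℝ) (y : ZM) (j : Fin 3) : foldCfg μ y (edgeOf j) = gnoPoint (fun a => μ * y (j, a)) := rfl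

/-- `echoCfg` on link `0` and on the other links. [folklore] -/
theorem echoCfg_edgeOf (L : ℕ) (μ : ℝ) (y : ZM) (j : Fin 3) :
    echoCfg L μ y (edgeOf j) = if j = 0 then echoLink L (gnoPoint (fun a => μ * y (j, a))) else gnoPoint (fun a => μ * y (j, a)) := rfl

/-- `gnCoord μ (foldCfg μ y) = y` (`μ ≠ 0`). [folklore] -/
theorem gnCoord_foldCfg {μ : ℝ} (hμ : μ ≠ 0) (y : ZM) : gnCoord μ (foldCfg μ y) = y := by
  ext p
  rw [gnCoord_apply, foldCfg_edgeOf, gnLink_gnoPoint]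
  field_simp

/-- `|gn(P(1, μ·y_j))| = |μ|·√(linkNormSq y j)`. [folklore] -/
theorem gnNorm_gnoPoint_link (μ : ℝ) (y : ZM) (j : Fin 3) :
    gnNorm (gnoPoint (fun a => μ * y (j, a))) = |μ| * Real.sqrt (linkNormSq y j) := by
  unfold gnNorm linkNormSq
  rw [gnLink_gnoPoint]
  have : ∑ a, (μ * y (j, a)) ^ 2 = μ ^ 2 * ∑ a, y (j, a) ^ 2 := by simp only [mul_pow, Finset.mul_sum]
  rw [this, Real.sqrt_mul (sq_nonneg μ), Real.sqrt_sq_eq_abs]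

/-- Every link of `foldCfg μ y` (and links `1,2` of `echoCfg`) is off the equator. [folklore] -/
theorem scalarPart_foldCfg_pos (μ : ℝ) (y : ZM) (e : Literature.MathematicalPhysics.QuantumFieldTheory.Edge 3 1) :
    0 < scalarPart (foldCfg μ y e) := scalarPart_gnoPoint_pos _

/-- Every link of `echoCfg L μ y` is off the equator. [folklore] -/
theorem scalarPart_echoCfg_pos (L : ℕ) (μ : ℝ) (y : ZM) (e : Literature.MathematicalPhysics.QuantumFieldTheory.Edge 3 1) :
    0 < scalarPart (echoCfg L μ y e) := by
  unfold echoCfg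
  split_ifs
  · exact scalarPart_echoLink_pos _ _
  · exact scalarPart_foldCfg_pos μ y e

/-- The fold configuration is `L`-near-centre on every link when `L·μ·‖y‖ < π/2` (`μ > 0`). [folklore] -/
theorem isNearCentre_foldCfg {μ : ℝ} (hμ : 0 < μ) {L : ℕ} {y : ZM} (hsmall : (L : ℝ) * (μ * ‖y‖) < π / 2) (j : Fin 3) :
    IsNearCentre L (foldCfg μ y (edgeOf j)) := by
  refine isNearCentre_of_gnCoord hμ (fun e => (scalarPart_foldCfg_pos μ y e).ne') ?_ j
  rwa [gnCoord_foldCfg hμ.ne']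

/-- ★ **The powered echo configuration has the same gnomonic coordinates as the powered fold configuration** (link `0` of `y` non-zero, echo angle `< π/2`).
[cite: BrockerTomDieck1985, I (1.10)] -/
theorem gnCoord_powLink_echoCfg {L : ℕ} (hL : 0 < L) {μ : ℝ} (hμ : 0 < μ) {y : ZM} (hy0 : 0 < linkNormSq y 0)
    (hang : π / L + Real.arctan (μ * Real.sqrt (linkNormSq y 0)) < π / 2) (ν : ℝ) :
    gnCoord ν (powLink L (echoCfg L μ y)) = gnCoord ν (powLink L (foldCfg μ y)) := by
  have hW : 0 < gnNorm (gnoPoint (fun a => μ * y (0, a))) := by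
    rw [gnNorm_gnoPoint_link, abs_of_pos hμ]; exact mul_pos hμ (Real.sqrt_pos.mpr hy0)
  have hang' : π / L + Real.arctan (gnNorm (gnoPoint (fun a => μ * y (0, a)))) < π / 2 := by
    rwa [gnNorm_gnoPoint_link, abs_of_pos hμ]
  ext p
  rw [gnCoord_apply, gnCoord_apply, powLink_apply, powLink_apply, echoCfg_edgeOf, foldCfg_edgeOf]
  by_cases h : p.1 = 0
  · rw [if_pos h, h, gnLink_echoLink_pow hL (scalarPart_gnoPoint_pos _) hW hang']
  · rw [if_neg h]

/-- Hence the root chart reads the same point: `rootCoord L ν (powLink L (echoCfg L μ y)) = rootCoord L ν (powLink L (foldCfg μ y))`. [folklore] -/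
theorem rootCoord_powLink_echoCfg {L : ℕ} (hL : 0 < L) {μ : ℝ} (hμ : 0 < μ) {y : ZM} (hy0 : 0 < linkNormSq y 0)
    (hang : π / L + Real.arctan (μ * Real.sqrt (linkNormSq y 0)) < π / 2) (ν : ℝ) :
    rootCoord L ν (powLink L (echoCfg L μ y)) = rootCoord L ν (powLink L (foldCfg μ y)) := by
  unfold rootCoord
  rw [gnCoord_powLink_echoCfg hL hμ hy0 hang]

variable {k : ℕ}

/-- ★★ **On the echo configuration of `y` the one-site shadow of the transplanted observable takes its value AT `y`**:
`transplantObsL L Λ R f i (powLink L (echoCfg L μ y)) = transplantFn R f i y`, `μ = Λ/(2L)`, for `y` with `L·μ·‖y‖ < π/2`, `y_0 ≠ 0`, echo angle `< π/2`.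
[cite: Luscher1983, §2–§3] -/
theorem transplantObsL_powLink_echoCfg {L : ℕ} (hL : 0 < L) {Λ : ℝ} (hΛ : 0 < Λ) (R : ℝ) (f : Fin (k + 1) → ZM → ℝ) (i : Fin k) {y : ZM}
    (hsmall : (L : ℝ) * (Λ / (2 * L) * ‖y‖) < π / 2) (hy0 : 0 < linkNormSq y 0)
    (hang : π / L + Real.arctan (Λ / (2 * L) * Real.sqrt (linkNormSq y 0)) < π / 2) :
    transplantObsL L Λ R f i (powLink L (echoCfg L (Λ / (2 * L)) y)) = transplantFn R f i y := by
  have hL' : (0 : ℝ) < L := Nat.cast_pos.mpr hL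
  have hμ : 0 < Λ / (2 * L) := div_pos hΛ (by positivity)
  have h1 : transplantObsL L Λ R f i (powLink L (echoCfg L (Λ / (2 * L)) y)) = transplantObsL L Λ R f i (powLink L (foldCfg (Λ / (2 * L)) y)) := by
    unfold transplantObsL
    rw [rootCoord_powLink_echoCfg hL hμ hy0 hang]
  rw [h1, transplantObsL_powLink hL hΛ R f i (isNearCentre_foldCfg hμ hsmall), gnCoord_foldCfg hμ.ne']

/-- The gnomonic coordinate of the echo configuration: link `0` is `y_0` stretched to gnomonic radius `tan(π/L + θ_0)/μ`, links `1, 2` are `y_1, y_2`. [folklore] -/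
theorem gnCoord_echoCfg_apply {L : ℕ} {μ : ℝ} (hμ : 0 < μ) (y : ZM) (p : Fin 3 × Fin 3) :
    gnCoord μ (echoCfg L μ y) p =
      if p.1 = 0 then Real.tan (π / L + Real.arctan (μ * Real.sqrt (linkNormSq y 0))) / (μ * Real.sqrt (linkNormSq y 0)) * y p else y p := by
  rw [gnCoord_apply, echoCfg_edgeOf]
  by_cases h : p.1 = 0
  · rw [if_pos h, if_pos h, gnLink_echoLink, gnNorm_gnoPoint_link, abs_of_pos hμ, Pi.smul_apply, smul_eq_mul, gnLink_gnoPoint, h]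
    have : y p = y (0, p.2) := by rw [← h]
    rw [this]
    field_simp
  · rw [if_neg h, if_neg h, gnLink_gnoPoint]
    field_simp

/-- Link `0` of the echo configuration sits at gnomonic radius `tan(π/L + θ_0)/μ ≥ (π/L)/μ`: `linkNormSq (gnCoord μ (echoCfg L μ y)) 0 = tan²(π/L + θ_0)/μ²`. [folklore] -/
theorem linkNormSq_gnCoord_echoCfg_zero {L : ℕ} {μ : ℝ} (hμ : 0 < μ) {y : ZM} (hy0 : 0 < linkNormSq y 0) :
    linkNormSq (gnCoord μ (echoCfg L μ y)) 0 = (Real.tan (π / L + Real.arctan (μ * Real.sqrt (linkNormSq y 0))) / μ) ^ 2 := by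
  have hc : ∀ a, gnCoord μ (echoCfg L μ y) (0, a) =
      Real.tan (π / L + Real.arctan (μ * Real.sqrt (linkNormSq y 0))) / (μ * Real.sqrt (linkNormSq y 0)) * y (0, a) := fun a => by
    rw [gnCoord_echoCfg_apply hμ, if_pos rfl]
  have hs : 0 < Real.sqrt (linkNormSq y 0) := Real.sqrt_pos.mpr hy0
  have hs2 : Real.sqrt (linkNormSq y 0) ^ 2 = linkNormSq y 0 := Real.sq_sqrt hy0.le
  generalize ht : Real.tan (π / L + Real.arctan (μ * Real.sqrt (linkNormSq y 0))) = t at hc ⊢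
  generalize hσ : Real.sqrt (linkNormSq y 0) = σ at hc hs hs2 ⊢
  have h1 : linkNormSq (gnCoord μ (echoCfg L μ y)) 0 = (t / (μ * σ)) ^ 2 * linkNormSq y 0 := by
    unfold linkNormSq
    rw [Finset.mul_sum]
    exact Finset.sum_congr rfl fun a _ => by rw [hc a, mul_pow]
  rw [h1, ← hs2]
  field_simp

/-- The other links are untouched: `linkNormSq (gnCoord μ (echoCfg L μ y)) j = linkNormSq y j` for `j ≠ 0`. [folklore] -/
theorem linkNormSq_gnCoord_echoCfg_ne {L : ℕ} {μ : ℝ} (hμ : 0 < μ) (y : ZM) {j : Fin 3} (hj : j ≠ 0) :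
    linkNormSq (gnCoord μ (echoCfg L μ y)) j = linkNormSq y j := by
  unfold linkNormSq
  refine Finset.sum_congr rfl fun a _ => ?_
  rw [gnCoord_echoCfg_apply hμ, if_neg hj]


/-- `scalarPart (W^m) = cos(m·θ)`, `θ = arctan|gn W|`, for `W` in the open upper hemisphere. [cite: BrockerTomDieck1985, I (1.10)] -/
theorem scalarPart_pow_of_scalarPart_pos {W : SU2} (hs : 0 < scalarPart W) (m : ℕ) :
    scalarPart (W ^ m) = Real.cos (m * Real.arctan (gnNorm W)) := by
  obtain ⟨hcos, hsin, -, -⟩ := angle_of_scalarPart_pos hs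
  have hq0 : 0 ≤ ∑ b, vecPart W b ^ 2 := Finset.sum_nonneg fun _ _ => sq_nonneg _
  obtain ⟨hsc, -⟩ := scalarPart_pow_vecPart_pow W m
  have hps : powSeq (scalarPart W) (∑ b, vecPart W b ^ 2) = powSeq (Real.cos (Real.arctan (gnNorm W))) (Real.sin (Real.arctan (gnNorm W)) ^ 2) := by
    rw [hcos, hsin, Real.sq_sqrt hq0]
  rw [hps, (powSeq_trig _ m).1] at hsc
  exact hsc

/-- The gnomonic coordinates of the POWERED fold configuration: block `j` is `y_j` stretched by `tan(L·θ_j)/(ν·√(linkNormSq y j))`, `θ_j = arctan(μ√(linkNormSq y j))`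
(`y_j ≠ 0`). [cite: BrockerTomDieck1985, I (1.10)] -/
theorem gnCoord_powLink_foldCfg_apply {L : ℕ} {μ : ℝ} (hμ : 0 < μ) (ν : ℝ) {y : ZM} (p : Fin 3 × Fin 3) (hy : 0 < linkNormSq y p.1) :
    gnCoord ν (powLink L (foldCfg μ y)) p =
      Real.tan (L * Real.arctan (μ * Real.sqrt (linkNormSq y p.1))) / (ν * Real.sqrt (linkNormSq y p.1)) * y p := by
  have hs : 0 < Real.sqrt (linkNormSq y p.1) := Real.sqrt_pos.mpr hy
  rw [gnCoord_apply, powLink_apply, foldCfg_edgeOf, gnLink_pow_of_scalarPart_pos (scalarPart_gnoPoint_pos _) L, gnNorm_gnoPoint_link, abs_of_pos hμ,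
    gnLink_gnoPoint]
  field_simp

/-- `linkNormSq (gnCoord ν (powLink L (foldCfg μ y))) j = tan²(L·θ_j)/ν²` (`y_j ≠ 0`, `ν ≠ 0`). [cite: BrockerTomDieck1985, I (1.10)] -/
theorem linkNormSq_gnCoord_powLink_foldCfg {L : ℕ} {μ : ℝ} (hμ : 0 < μ) {ν : ℝ} (hν : ν ≠ 0) {y : ZM} (j : Fin 3) (hy : 0 < linkNormSq y j) :
    linkNormSq (gnCoord ν (powLink L (foldCfg μ y))) j = (Real.tan (L * Real.arctan (μ * Real.sqrt (linkNormSq y j))) / ν) ^ 2 := by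
  have hc : ∀ a, gnCoord ν (powLink L (foldCfg μ y)) (j, a) =
      Real.tan (L * Real.arctan (μ * Real.sqrt (linkNormSq y j))) / (ν * Real.sqrt (linkNormSq y j)) * y (j, a) := fun a =>
    gnCoord_powLink_foldCfg_apply hμ ν (j, a) hy
  have hs : 0 < Real.sqrt (linkNormSq y j) := Real.sqrt_pos.mpr hy
  have hs2 : Real.sqrt (linkNormSq y j) ^ 2 = linkNormSq y j := Real.sq_sqrt hy.le
  generalize ht : Real.tan (L * Real.arctan (μ * Real.sqrt (linkNormSq y j))) = t at hc ⊢
  generalize hσ : Real.sqrt (linkNormSq y j) = σ at hc hs hs2 ⊢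
  have h1 : linkNormSq (gnCoord ν (powLink L (foldCfg μ y))) j = (t / (ν * σ)) ^ 2 * linkNormSq y j := by
    unfold linkNormSq
    rw [Finset.mul_sum]
    exact Finset.sum_congr rfl fun a _ => by rw [hc a, mul_pow]
  rw [h1, ← hs2]
  field_simp

end Summit.QuantumFields.YangMills.Theorems.FemtoTransferGap.PolyakovLift.Negative

end
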